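import Summits.HodgeConjecture.HodgeConjecture.Theorems.TropicalKugaSatakeCayleyEffectiveCayleyNonRealizabilitySixthDirectionRung
import Summits.HodgeConjecture.HodgeConjecture.Theorems.TropicalKugaSatakeCayleyDefs
import HarnessLib

/-!
# The sixth-direction CRITERION for the Kuga–Satake family and the bet `stub_formalCoreRigidity`
# modulo it — crux `EffectiveCayleyNonRealizability` (stmt-HodgeConjecture-18569), line `formal_rational`

Route `TropicalKugaSatakeCayley` of `HodgeConjecture`. Consequences of the kernel certificate
`K₊ ∩ ℚ^{28×28} = ℚ • 1` (`…SixthDirectionRung`) for the FIVE-parameter family `F_KS` itself: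

* `kernelKS_eq_smul_one_of_sixth` — **the sixth-direction criterion**: a rational class `Mq` in the
  class space `K = {M | ∀ t, eigenwave (compound 2 (ksMatrix t) · M) = 0}` of the Kuga–Satake family
  (`dim K ∩ ℚ = 6 = θ ⊕ 5 Cayley`) is a multiple of `1` as soon as it is ALSO killed by the eigenwave
  of the sixth direction `B₆ = D R₂R₃R₄R₅`: the single linear map `M ↦ eigenwave (compound 2 B₆ · M)`
  detects the Cayley part of `K`.
* `formalCoreRigidity_of_sixthDirectionVanishing` — **the bet modulo one linear condition**: the
  registered stub `stub_formalCoreRigidity` (the transferred core C⁺ of the crux, stated with the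
  line's devices `ksMatrixPoly` / `evalChain` of `TropicalKugaSatakeCayleyDefs`) FOLLOWS from
  "SIXTH-DIRECTION VANISHING": the rational period class of every affine-linear formal cycle of
  `F_KS` that is effective with constant class on a non-empty open subset of the cone is killed by
  `eigenwave ∘ compound 2 B₆`. (The converse implication is immediate from `eigenwave (compound 2 B₆) = 0`,
  `B₆` symmetric; not recorded here.) This is the CLASS-LEVEL form of the prior programme's
  "automatic sixth flexibility": refuted at the level of complexes (exactly-`F_KS`-rigid theta
  complexes exist), it is, at the level of classes, equivalent to the bet — and it is ONE explicit
  family of three-term identities `Σ_cyc c₆(k₁) N(k₁ ⊕ 7; k₂, k₃) = 0` on the antisymmetric reading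
  `N` of the class (the `l = 5` rows of `…SixthDirectionKernelBlock`), a concrete target for the
  crux's disprover: an effective formal `F_KS`-cycle violating one of them refutes the crux.

No definition, no named fact, no sorry.
References: [MikhalkinZharkov2014Eigenwave] G. Mikhalkin, I. Zharkov, Tropical eigenwave and
intermediate Jacobians, LN UMI 15 (2014), Thm. 5.4; [Zharkov2020TropicalWeil] I. Zharkov,
arXiv:2002.02347, pp. 2–3; prior programme archive `hodge-neg/tropical-kuga-satake`, paper-v2 §5
and structure.md §4 (ASF refuted for complexes).
-/

noncomputable section

-- `Summit.HodgeConjecture.HodgeConjecture.…` is the mandated namespace (single-conjunct summit).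
set_option linter.dupNamespace false

open scoped BigOperators Matrix

namespace Summit.HodgeConjecture.HodgeConjecture.Theorems.EffectiveCayleyNonRealizability

open Literature.AlgebraicGeometry.Tropical
open Literature.AlgebraicGeometry.Tropical.TropicalTorus
open Summit.HodgeConjecture.HodgeConjecture.Theorems.TropicalKugaSatakeCayley

/-- The Kuga–Satake period matrix at a unit vector is the corresponding integral form. [folklore] -/
theorem ksMatrix_single (i : Fin 5) :
    ksMatrix (Pi.single i (1 : ℝ)) = (ksForm i).map (Int.cast : ℤ → ℝ) := by
  unfold ksMatrix
  have hc : ∀ i' : Fin 5, (Pi.single i (1 : ℝ) : Fin 5 → ℝ) i' = if i' = i then 1 else 0 :=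
    fun i' => by rw [Pi.single_apply]
  simp only [hc, ite_smul, one_smul, zero_smul, Finset.sum_ite_eq', Finset.mem_univ, if_true]

/-- **The sixth-direction criterion.** A rational class in the class space `K` of the Kuga–Satake
family (`eigenwave (compound 2 (ksMatrix t) · Mq) = 0` for all `t ∈ ℝ⁵`) that is also killed by the
eigenwave of the sixth direction `B₆ = D R₂R₃R₄R₅` is a rational multiple of `1`.
[cite: MikhalkinZharkov2014Eigenwave, Thm. 5.4] -/
theorem kernelKS_eq_smul_one_of_sixth (Mq : Matrix (Sub 8 2) (Sub 8 2) ℚ)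
    (hK : ∀ t : Fin 5 → ℝ, eigenwave (q := 1) (compound 2 (ksMatrix t) * Mq.map (algebraMap ℚ ℝ)) = 0)
    (h₆ : eigenwave (q := 1) (compound 2
      ((ksBase * ksClifford 0 * ksClifford 1 * ksClifford 2 * ksClifford 3).map (Int.cast : ℤ → ℚ)) *
        Mq) = 0) :
    ∃ r : ℚ, Mq = r • (1 : Matrix (Sub 8 2) (Sub 8 2) ℚ) := by
  refine sixthDirection_kernelCertificate_rat Mq fun l => ?_
  induction l using Fin.lastCases with
  | last =>
    rw [ksSixth_eq_lit] at h₆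
    exact h₆
  | cast i =>
    rw [sixthGenerators_castSucc]
    have e := hK (Pi.single i 1)
    rw [ksMatrix_single] at e
    exact (eigenwave_compound_intCast_eq_zero_iff _ Mq).1 e

/-- **The bet `stub_formalCoreRigidity` modulo sixth-direction vanishing.** If the rational period
class of every affine-linear formal cycle of the Kuga–Satake family that is effective with constant
class on a non-empty open subset of the cone is killed by `eigenwave ∘ compound 2 B₆`, then the
registered stub `stub_formalCoreRigidity` of line `formal_rational` holds (its statement verbatim,
with the line's devices `ksMatrixPoly` / `evalChain`). [cite: MikhalkinZharkov2014Eigenwave, Thm. 5.4]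
[cite: Zharkov2020TropicalWeil, pp. 2–3] -/
theorem formalCoreRigidity_of_sixthDirectionVanishing
    (H₆ : ∀ 𝒵 : Chain (MvPolynomial (Fin 5) ℚ) 8 2, 𝒵.IsAffineLinear → 𝒵.IsCycle ksMatrixPoly →
      ∀ V : Set (Fin 5 → ℝ), IsOpen V → V.Nonempty → V ⊆ ksPosCone →
        ∀ Mq : Matrix (Sub 8 2) (Sub 8 2) ℚ,
          (∀ t ∈ V, (evalChain t 𝒵).Effective ∧
            compound 2 (ksMatrix t)⁻¹ * (evalChain t 𝒵).classOf = Mq.map (algebraMap ℚ ℝ)) →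
          eigenwave (q := 1) (compound 2
            ((ksBase * ksClifford 0 * ksClifford 1 * ksClifford 2 * ksClifford 3).map
              (Int.cast : ℤ → ℚ)) * Mq) = 0) :
    ∀ 𝒵 : Chain (MvPolynomial (Fin 5) ℚ) 8 2, 𝒵.IsAffineLinear → 𝒵.IsCycle ksMatrixPoly →
      ∀ V : Set (Fin 5 → ℝ), IsOpen V → V.Nonempty → V ⊆ ksPosCone →
        ∀ Mq : Matrix (Sub 8 2) (Sub 8 2) ℚ,
          (∀ t ∈ V, (evalChain t 𝒵).Effective ∧
            compound 2 (ksMatrix t)⁻¹ * (evalChain t 𝒵).classOf = Mq.map (algebraMap ℚ ℝ)) →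
          ∃ r : ℚ, Mq = r • (1 : Matrix (Sub 8 2) (Sub 8 2) ℚ) := by
  intro 𝒵 hlin hcyc V hVo hVne hVcone Mq hV
  refine kernelKS_eq_smul_one_of_sixth Mq (fun t => ?_) (H₆ 𝒵 hlin hcyc V hVo hVne hVcone Mq hV)
  exact eigenwave_compound_ksMatrix_mul_eq_zero 𝒵 V hVo hVne hVcone Mq (fun t' ht' => (hV t' ht').2) t

end Summit.HodgeConjecture.HodgeConjecture.Theorems.EffectiveCayleyNonRealizability

end
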